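/-
Copyright (c) 2026 the pub-hodgecm-mathlib formalisation cell (harness21).  Prover seat hodgecm-mathlib-K2E4-p14 (g9), Track B ∕ K2-LIT, h413 = `stmt-HodgeConjecture-24833`,
line `K2_E1_TraceFormulaBeta`, campaign 5Res ∕ 12R3 (ROADCARD §3′ M2 v2), deal (243) of the dealer K2E1-plan (g7): THE (EXH) GLUE — finitely many pairwise orthogonal family blocks
exhausting `Eis`, each with a coordinate map injective on its block ⟹ the joint injectivity `hEXH` consumed by ★∕📤 `K2E1ResidueAtomsOfNoLineMassU.hatoms_of_noLineMass` (this seat, (242)).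
-/
import Summits.HodgeConjecture.HodgeConjecture.Theorems.K2E1CuspidalSpectrumUnitaryDefs   -- ★ `AdelicGroupData.L2` (for the `𝒢`-print only)
import Mathlib.Analysis.InnerProductSpace.Projection.FiniteDimensional
import HarnessLib

/-!
# K2·E1 — `K2E1FamilyExhaustionInjectiveU`: ORTHOGONAL FAMILY BLOCKS EXHAUSTING `Eis` + BLOCKWISE INJECTIVE COORDINATES ⟹ JOINT INJECTIVITY ON `Eis` (the (EXH) glue; abstract
# Hilbert space, then the `𝒢`-print)

Track B ∕ K2-LIT, crux h413 = `stmt-HodgeConjecture-24833`, route of record `HCCMUnconditional`; cell `hodgecm-mathlib`, squad K2, ENGINE E1 (campaign 5Res ∕ 12R3, ROADCARD §3′ M2 v2).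
THEOREMS ONLY (no `def`, no `instance`, no notation, no named-fact hypothesis, no `sorry`); lane `--supports stmt-HodgeConjecture-24833 --as helper` (count-neutral).  Closes no socket.

THE ARGUMENT (dealer (243)).  `Blk b ≤ H` (`b ∈ β` FINITE) complete, pairwise ORTHOGONAL subspaces ((XF): ★ GR-χ ∕ H-b), `Eis ≤ closure (⨆_b Blk b)` (the C7 HEAD, 📤 p860399's
`orthogonal_inf_invariants_le_topologicalClosure_iSup_family`), and per block a linear coordinate `V b : H →ₗ X b` INJECTIVE ON `Blk b` (the D4′c isometries); put `U b := V b ∘ P_{Blk b}`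
(orthogonal projection).  On the algebraic sum `Σ_b P_{Blk b} = id` (Mathlib `OrthogonalFamily.sum_projection_of_mem_iSup`); both sides are continuous, so the identity persists on the
closure (§1): `x = Σ_b P_{Blk b} x` for `x ∈ Eis`.  If `U b x = 0` for all `b`, then `P_{Blk b} x ∈ Blk b` is killed by `V b`, hence `0`, and `x = 0` (§2) — the `hEXH` binder of
`hatoms_of_noLineMass`.
* §1 `eq_sum_starProjection_of_mem_topologicalClosure_iSup` — `x ∈ closure (⨆_b Blk b) ⟹ x = Σ_b P_{Blk b} x` (finite pairwise-orthogonal complete family).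
* §2 **`exhaustion_injective`** — ABSTRACT (EXH): `∀ x ∈ Eis, (∀ b, V b (P_{Blk b} x) = 0) → x = 0`.
* §3 `𝒢`-PRINT **`hEXH_of_orthogonalBlocks`** — on `H := L²(μ)` with `X b := A b × L b`: the `hEXH` binder of ★∕📤 `hatoms_of_noLineMass` VERBATIM for `U b := V b ∘ₗ P_{Blk b}`.
HONEST LABEL: HC_CM is proved only modulo the 7 printed citations (2 remaining named inputs: hLiu418 = `stmt-HodgeConjecture-24832`, h413 = `stmt-HodgeConjecture-24833`) until rung 0
closes; this file asserts no named fact and closes no socket; count-neutral; CONDITIONAL on the block data ((XF) orthogonality, the C7 exhaustion, the D4′c injectivity) its binders name.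

## References
* [MoeglinWaldspurger1995] C. Mœglin, J.-L. Waldspurger, *Spectral decomposition and Eisenstein series* (1995), II.2.4, V.3.13.
* [ReedSimonI1980] M. Reed, B. Simon, *Methods of Modern Mathematical Physics I* (1980), Thm. II.3.
-/

set_option autoImplicit false
-- the mandated namespace repeats the single-problem summit's segment (`HodgeConjecture.HodgeConjecture`)
set_option linter.dupNamespace false

noncomputable section

open MeasureTheory Set
open Literature.NumberTheory.Automorphic

namespace Summit.HodgeConjecture.HodgeConjecture.Cruxes.H413.K2E1FamilyExhaustionInjectiveU

universe u

/-! ## §1–§2 Abstract Hilbert space -/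

section Abstract

variable {H : Type*} [NormedAddCommGroup H] [InnerProductSpace ℂ H]
variable {β : Type*} [Fintype β]

/-- **`x = Σ_b P_{Blk b} x` ON THE CLOSURE OF THE SUM** of a finite pairwise-orthogonal family of complete subspaces: Mathlib's `OrthogonalFamily.sum_projection_of_mem_iSup` on the
algebraic sum, extended to the closure because both sides are continuous in `x`. [cite: ReedSimonI1980, Thm. II.3] -/
theorem eq_sum_starProjection_of_mem_topologicalClosure_iSup (Blk : β → Submodule ℂ H) [∀ b, CompleteSpace (Blk b)]
    (horth : Pairwise fun b b' => Blk b ⟂ Blk b') {x : H} (hx : x ∈ (⨆ b, Blk b).topologicalClosure) :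
    x = ∑ b, (Blk b).starProjection x := by
  have hV : OrthogonalFamily ℂ (fun b => Blk b) fun b => (Blk b).subtypeₗᵢ := orthogonalFamily_iff_pairwise.2 horth
  -- the equaliser `{y | Σ_b P_b y = y}` is closed and contains the algebraic sum
  have hcl : IsClosed {y : H | (∑ b, (Blk b).starProjection y) = y} :=
    isClosed_eq (continuous_finsetSum _ fun b _ => (Blk b).starProjection.continuous) continuous_id
  have hsub : ((⨆ b, Blk b : Submodule ℂ H) : Set H) ⊆ {y : H | (∑ b, (Blk b).starProjection y) = y} :=
    fun y hy => hV.sum_projection_of_mem_iSup y hy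
  have hx' : x ∈ closure ((⨆ b, Blk b : Submodule ℂ H) : Set H) := by rwa [← Submodule.topologicalClosure_coe]
  exact ((hcl.closure_subset_iff.2 hsub) hx').symm

/-- **(EXH) — JOINT INJECTIVITY ON `Eis`**: `Blk b` (`b ∈ β` finite) complete pairwise-orthogonal subspaces with `Eis ≤ closure (⨆_b Blk b)`, and linear `V b : H →ₗ X b` injective on
`Blk b`; then `x ∈ Eis` with `V b (P_{Blk b} x) = 0` for all `b` is `0`. [cite: MoeglinWaldspurger1995, II.2.4, V.3.13] -/
theorem exhaustion_injective (Blk : β → Submodule ℂ H) [∀ b, CompleteSpace (Blk b)] (horth : Pairwise fun b b' => Blk b ⟂ Blk b')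
    (Eis : Submodule ℂ H) (hEis : Eis ≤ (⨆ b, Blk b).topologicalClosure)
    {X : β → Type*} [∀ b, AddCommGroup (X b)] [∀ b, Module ℂ (X b)] (V : ∀ b, H →ₗ[ℂ] X b) (hV : ∀ b, ∀ y ∈ Blk b, V b y = 0 → y = 0) :
    ∀ x ∈ Eis, (∀ b, (V b ∘ₗ ((Blk b).starProjection : H →L[ℂ] H).toLinearMap) x = 0) → x = 0 := by
  intro x hx h0
  rw [eq_sum_starProjection_of_mem_topologicalClosure_iSup Blk horth (hEis hx)]
  refine Finset.sum_eq_zero fun b _ => hV b _ ((Blk b).starProjection_apply_mem x) ?_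
  simpa only [LinearMap.comp_apply, ContinuousLinearMap.coe_coe] using h0 b

end Abstract

/-! ## §3 The `𝒢`-print: the `hEXH` binder of `hatoms_of_noLineMass` -/

section Residual

variable {F : Type} [Field F] [NumberField F] (𝒢 : AdelicGroupData.{u} F) (μ : Measure 𝒢.automorphicQuotient)
variable {β : Type*} [Fintype β] {A L : β → Type*} [∀ b, AddCommGroup (A b)] [∀ b, Module ℂ (A b)] [∀ b, AddCommGroup (L b)] [∀ b, Module ℂ (L b)]

/-- **(EXH) ON `L²(G(F)∖G(𝔸), μ)`** (dealer (243)): for finitely many complete pairwise-orthogonal family blocks `Blk b ≤ L²` whose closed sum contains `Eis`, and family coordinates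
`V b : L² →ₗ A b × L b` injective on `Blk b` (the D4′ isometries in atom × line form), the maps `U b := V b ∘ P_{Blk b}` are jointly injective on `Eis` — the `hEXH` binder of ★∕📤
`K2E1ResidueAtomsOfNoLineMassU.hatoms_of_noLineMass` VERBATIM. [cite: MoeglinWaldspurger1995, II.2.4, V.3.13] -/
theorem hEXH_of_orthogonalBlocks (Blk : β → Submodule ℂ (𝒢.L2 μ)) [∀ b, CompleteSpace (Blk b)] (horth : Pairwise fun b b' => Blk b ⟂ Blk b')
    (Eis : Submodule ℂ (𝒢.L2 μ)) (hEis : Eis ≤ (⨆ b, Blk b).topologicalClosure)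
    (V : ∀ b, 𝒢.L2 μ →ₗ[ℂ] (A b × L b)) (hV : ∀ b, ∀ y ∈ Blk b, V b y = 0 → y = 0) :
    ∀ x ∈ Eis, (∀ b, (V b ∘ₗ ((Blk b).starProjection : 𝒢.L2 μ →L[ℂ] 𝒢.L2 μ).toLinearMap) x = 0) → x = 0 :=
  exhaustion_injective Blk horth Eis hEis V hV

end Residual

end Summit.HodgeConjecture.HodgeConjecture.Cruxes.H413.K2E1FamilyExhaustionInjectiveU

end
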